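import Mathlib.Geometry.Manifold.VectorField.Pullback
import Literature.Geometry.Lorentzian.KillingHorizonShadowAlong
import Literature.Geometry.Lorentzian.EinsteinTensorNaturality
import Literature.Geometry.Lorentzian.ImmersedChartRicci
import Literature.Geometry.Lorentzian.ChartMetricCoord
import Literature.Geometry.Lorentzian.KerrKillingTangency
import Literature.Geometry.Lorentzian.SpacetimeLocalConvergence
import Literature.Geometry.Lorentzian.SpacetimeMetricInCoordsCalculus
import Literature.Geometry.Manifold.InjOnLocalDiffeomorphInverse
import HarnessLib

/-!
# Crux `GapExhaustion` (stmt-FinalStateConjecture-10808), line `photon-shell-pseudoconvexity`: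
# stub `stub_ricAtChart_and_killingLocality` — the coordinate Ricci form of an immersed chart of a
# Ricci-flat spacetime vanishes, and locality of `IsKillingFieldOn`

Route `BartnikGapSettling`; helper (`--supports stmt-FinalStateConjecture-10808`) landing the
registered stub `stub_ricAtChart_and_killingLocality` of the outward Killing-extension sweep S5 of
the line's node, which is assembled from the Ionescu–Klainerman local extension theorem in chart
form (hypothesis `ricAt G x = 0` on a coordinate ball) and from coordinate/manifold bridges. Three
small manifold-side facts are supplied here, as one conjunction:

1. `killingLoc_ricAt_metricInCoords_eq_zero` — for an immersed chart `Φ : E4 → 𝓢.carrier`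
   (smooth on the open `W`, injective differential) of a **Ricci-flat** spacetime `𝓢`, the
   coordinate Ricci form of the pulled-back components `G = 𝓢.metricInCoords Φ` vanishes on `W`:
   `ricAt G y = 0` for `y ∈ W`. This is the bridge `ricci_immersedChart_eq_ricAt'`
   (`Ric^g_{Φ y}(dΦ_y v, dΦ_y w) = ricAt G y v w`, O'Neill 1983, Ch. 3, Prop. 3.59 and
   Lemma 3.52) combined with `IsRicciFlat` (`Ric^g = 0`).
2. `killingLoc_isKillingFieldOn_congr` — `IsKillingFieldOn K U` only depends on the values of
   `K` on the **open** set `U`: smoothness transfers by `ContMDiffOn.congr`, and the Levi-Civita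
   covariant derivative is local on sections differentiable at the point (Mathlib's
   `IsCovariantDerivativeOn.congr_of_eventuallyEq`), so the Killing equation transfers too.
3. `killingLoc_isKillingFieldOn_union` — a field which is Killing on two open sets is Killing on
   their union (smoothness is local: `ContMDiffAt` at each point of either open set).

O'Neill 1983, Ch. 9, Def. 22 and Prop. 25 (Killing fields on open subsets); Ch. 3, Prop. 3.59.
-/

noncomputable section

set_option maxSynthPendingDepth 3

-- D-0017: single-problem summit, `Summit.<S>.<S>.…` by design (cf. lakefile `weak.linter.dupNamespace`).
set_option linter.dupNamespace false

namespace Summit.FinalStateConjecture.FinalStateConjecture.Theorems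

open Set Function Bundle TopologicalSpace
open Literature.Geometry.Lorentzian Literature.Geometry.Lorentzian.MetricCoord
open scoped Manifold ContDiff Topology

/-- **The coordinate Ricci form of an immersed chart of a Ricci-flat spacetime vanishes.** For
`Φ : E4 → 𝓢.carrier` smooth on the open set `W` with injective differential there and `𝓢`
Ricci-flat, `ricAt (𝓢.metricInCoords Φ) y = 0` for every `y ∈ W`: by the bridge
`ricci_immersedChart_eq_ricAt'`, `ricAt (𝓢.metricInCoords Φ) y v w = Ric^g_{Φ y}(dΦ_y v, dΦ_y w)`,
and `Ric^g = 0`. [cite: ONeill1983, Ch. 3, Prop. 3.59 and Lemma 3.52] -/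
theorem killingLoc_ricAt_metricInCoords_eq_zero (𝓢 : Spacetime.{0} 4) [𝓢.metric.HasLeviCivita]
    (Φ : E4 → 𝓢.carrier) (W : Set E4) (hW : IsOpen W)
    (hΦ : ContMDiffOn 𝓘(ℝ, E4) (𝓡 4) ∞ Φ W)
    (hinj : ∀ y ∈ W, Function.Injective (mfderiv 𝓘(ℝ, E4) (𝓡 4) Φ y))
    (hRF : 𝓢.metric.toPseudoRiemannianMetric.IsRicciFlat) {y : E4} (hy : y ∈ W) :
    ricAt (𝓢.metricInCoords Φ) y = 0 := by
  set A : Opens E4 := ⟨W, hW⟩ with hAdef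
  have hΦA : ContMDiffOn 𝓘(ℝ, E4) (𝓡 4) ∞ Φ A := hΦ
  have hinjA : ∀ z ∈ A, Function.Injective (mfderiv 𝓘(ℝ, E4) (𝓡 4) Φ z) := hinj
  have hyA : y ∈ A := hy
  ext v w
  have hbridge : 𝓢.metric.toPseudoRiemannianMetric.ricci (Φ y) (mfderiv 𝓘(ℝ, E4) (𝓡 4) Φ y v)
      (mfderiv 𝓘(ℝ, E4) (𝓡 4) Φ y w) = ricAt (𝓢.metricInCoords Φ) y v w :=
    ricci_immersedChart_eq_ricAt' 𝓢.metric.toPseudoRiemannianMetric hΦA hinjA rfl hyA v w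
  rw [← hbridge, hRF (Φ y)]
  simp

/-- **`IsKillingFieldOn` is local in the field on an open set.** If `K'` agrees with `K` on the
open set `U` and `K` is a Killing field of `𝓢` on `U`, so is `K'`: the bundle sections agree on
`U` (`ContMDiffOn.congr`), and at `x ∈ U` both sections are differentiable and agree near `x`, so
`∇K' (x) = ∇K (x)` by locality of covariant derivatives
(`IsCovariantDerivativeOn.congr_of_eventuallyEq`), whence the Killing equation for `K'`.
[cite: ONeillSemiRiemannian1983, Ch. 9, Def. 22 and Prop. 25 (3) (p. 251)] -/
theorem killingLoc_isKillingFieldOn_congr (𝓢 : Spacetime.{0} 4) [𝓢.metric.HasLeviCivita]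
    (U : Set 𝓢.carrier) (K K' : Π x : 𝓢.carrier, TangentSpace (𝓡 4) x) (hU : IsOpen U)
    (hKK' : ∀ x ∈ U, K' x = K x)
    (hK : 𝓢.metric.toPseudoRiemannianMetric.IsKillingFieldOn K U) :
    𝓢.metric.toPseudoRiemannianMetric.IsKillingFieldOn K' U := by
  set g := 𝓢.metric.toPseudoRiemannianMetric with hgdef
  refine ⟨hK.1.congr fun x hx ↦ ?_, fun x hx Y₀ Z₀ ↦ ?_⟩
  · simp only [hKK' x hx]
  · have hKd : MDifferentiableAt (𝓡 4) (𝓡 4).tangent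
        (fun x ↦ (TotalSpace.mk' E4 x (K x) : TangentBundle (𝓡 4) 𝓢.carrier)) x :=
      hK.mdifferentiableAt hU hx
    have heq : ∀ᶠ y in 𝓝 x, K' y = K y := Filter.eventually_of_mem (hU.mem_nhds hx) hKK'
    have hK'd : MDifferentiableAt (𝓡 4) (𝓡 4).tangent
        (fun x ↦ (TotalSpace.mk' E4 x (K' x) : TangentBundle (𝓡 4) 𝓢.carrier)) x := by
      refine hKd.congr_of_eventuallyEq ?_
      filter_upwards [heq] with y hy
      simp only [hy]
    have hcov : g.leviCivita K' x = g.leviCivita K x :=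
      (g.leviCivita.isCovariantDerivativeOn (s := Set.univ)).congr_of_eventuallyEq hK'd hKd
        Filter.univ_mem heq
    rw [hcov]
    exact hK.2 x hx Y₀ Z₀

/-- **Gluing Killing fields over two open sets.** A field which is a Killing field of `𝓢` on the
open sets `U` and `U'` is a Killing field on `U ∪ U'`: it is `C^∞` at each point of the union
(`IsKillingFieldOn.contMDiffAt` on whichever open set contains the point), and the Killing
equation holds pointwise. [cite: ONeillSemiRiemannian1983, Ch. 9, Def. 22 and Prop. 25 (3) (p. 251)] -/
theorem killingLoc_isKillingFieldOn_union (𝓢 : Spacetime.{0} 4) [𝓢.metric.HasLeviCivita]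
    (U U' : Set 𝓢.carrier) (K : Π x : 𝓢.carrier, TangentSpace (𝓡 4) x) (hU : IsOpen U)
    (hU' : IsOpen U') (hK : 𝓢.metric.toPseudoRiemannianMetric.IsKillingFieldOn K U)
    (hK' : 𝓢.metric.toPseudoRiemannianMetric.IsKillingFieldOn K U') :
    𝓢.metric.toPseudoRiemannianMetric.IsKillingFieldOn K (U ∪ U') := by
  refine ⟨fun x hx ↦ ?_, fun x hx Y₀ Z₀ ↦ ?_⟩
  · rcases hx with hx | hx
    · exact (hK.contMDiffAt hU hx).contMDiffWithinAt
    · exact (hK'.contMDiffAt hU' hx).contMDiffWithinAt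
  · rcases hx with hx | hx
    · exact hK.2 x hx Y₀ Z₀
    · exact hK'.2 x hx Y₀ Z₀

/-- **Stub `stub_ricAtChart_and_killingLocality` of the line `photon-shell-pseudoconvexity`
(crux `GapExhaustion`, stmt-FinalStateConjecture-10808).** Three manifold-side facts feeding the
outward Killing-extension sweep: (1) the coordinate Ricci form of the pulled-back components
`𝓢.metricInCoords Φ` of an immersed chart of a Ricci-flat spacetime vanishes on the chart domain
(`killingLoc_ricAt_metricInCoords_eq_zero`); (2) `IsKillingFieldOn K U` is invariant under
changing `K` to a field agreeing with it on the open set `U`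
(`killingLoc_isKillingFieldOn_congr`); (3) Killing on two open sets implies Killing on their
union (`killingLoc_isKillingFieldOn_union`). O'Neill 1983, Ch. 3, Prop. 3.59; Ch. 9, Def. 22,
Prop. 25. [cite: ONeillSemiRiemannian1983, Ch. 9, Def. 22 and Prop. 25 (3) (p. 251)] -/
theorem stub_ricAtChart_and_killingLocality :
    (∀ (𝓢 : Spacetime.{0} 4) [𝓢.metric.HasLeviCivita] (Φ : E4 → 𝓢.carrier) (W : Set E4),
      IsOpen W → ContMDiffOn 𝓘(ℝ, E4) (𝓡 4) ∞ Φ W →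
      (∀ y ∈ W, Function.Injective (mfderiv 𝓘(ℝ, E4) (𝓡 4) Φ y)) →
      𝓢.metric.toPseudoRiemannianMetric.IsRicciFlat →
      ∀ y ∈ W, ricAt (𝓢.metricInCoords Φ) y = 0) ∧
    (∀ (𝓢 : Spacetime.{0} 4) [𝓢.metric.HasLeviCivita] (U : Set 𝓢.carrier)
      (K K' : Π x : 𝓢.carrier, TangentSpace (𝓡 4) x), IsOpen U →
      (∀ x ∈ U, K' x = K x) →
      𝓢.metric.toPseudoRiemannianMetric.IsKillingFieldOn K U →
      𝓢.metric.toPseudoRiemannianMetric.IsKillingFieldOn K' U) ∧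
    (∀ (𝓢 : Spacetime.{0} 4) [𝓢.metric.HasLeviCivita] (U U' : Set 𝓢.carrier)
      (K : Π x : 𝓢.carrier, TangentSpace (𝓡 4) x), IsOpen U → IsOpen U' →
      𝓢.metric.toPseudoRiemannianMetric.IsKillingFieldOn K U →
      𝓢.metric.toPseudoRiemannianMetric.IsKillingFieldOn K U' →
      𝓢.metric.toPseudoRiemannianMetric.IsKillingFieldOn K (U ∪ U')) := by
  refine ⟨?_, ?_, ?_⟩
  · intro 𝓢 _ Φ W hW hΦ hinj hRF y hy
    exact killingLoc_ricAt_metricInCoords_eq_zero 𝓢 Φ W hW hΦ hinj hRF hy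
  · intro 𝓢 _ U K K' hU hKK' hK
    exact killingLoc_isKillingFieldOn_congr 𝓢 U K K' hU hKK' hK
  · intro 𝓢 _ U U' K hU hU' hK hK'
    exact killingLoc_isKillingFieldOn_union 𝓢 U U' K hU hU' hK hK'

end Summit.FinalStateConjecture.FinalStateConjecture.Theorems

end
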